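import Summits.QuantumAdvantage.QuantumAdvantage.Theorems.AvgFaceBeyondPrior.Negative.AvgFaceBeyondPriorNecessary
import Summits.QuantumAdvantage.QuantumAdvantage.Theorems.AvgFaceBeyondPrior.Negative.AvgFaceBeyondPriorBlocks
import Literature.Computability.Complexity.BPPErrorReduction
import Literature.Computability.Complexity.BranchingFn
import Literature.Computability.Complexity.StringCopy
import Literature.Computability.Complexity.CoinTruncation
import Literature.Computability.Complexity.PairProjections

/-!
# The mirror transfer for the crux `ArithStatLadder.AvgFaceBeyondPrior` (stmt-QuantumAdvantage-2427)

Stub `stub_heurTransfer` of the line `mirror-unit-signature`: if a set `T ⊆ ℕ` agrees with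
`IQ3 = {d : −d fundamental, 3 ∣ h(−d)}` off a `(1/6 + ε)`-fraction of every late dyadic block
`𝒟ₙ = Negative.fundBlock n`, and the binary language of `T` is in `BPP`, then `(IQ3, U)` IS in
`Heur_{1/3}BPP`, i.e. the crux `AvgFaceBeyondPrior` fails.

Proof (generic heuristic-class plumbing, [Bogdanov–Trevisan 2006, §2.3]):
* error reduction `BPP ⊆ bpErr P (1/8)` (`BPP_subset_bpErr`) gives a witness language `L' ∈ P`
  and a coin polynomial `p` whose verdict `[⟨x, r⟩ ∈ L']` is wrong about `x ∈ bin T` for at most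
  an eighth of the coin strings `r ∈ {0,1}^{p |x|}`;
* the agreement hypothesis at `ε = 1/6` gives a level `n₀ ≥ 2` from which on the disagreement set
  has counting density `≤ 1/3` in the block;
* THE ALGORITHM `B(⟨x, 1ⁿ⟩; r)`: if `⟨x, 1ⁿ⟩` lies in the finite table `S₀` of the codes
  `⟨bin d, 1ᵐ⟩`, `m < n₀`, `d ∈ 𝒟ₘ ∩ IQ3`, answer `1`; else if `n < n₀` answer `0`; else answer
  `[⟨x, r ↾ p(|x|)⟩ ∈ L']`. It is PPT: as a string function it is assembled from the tree's `FP`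
  toolkit (`iteFn_mem_FP`, finite tables by `eqPairFn`/`fanoutFn`, the pair projections, the
  coin truncation `truncSndFn`, and the deciding machine of `L'`, `indicatorFn_mem_FP`), then
  transported to typed inputs by `PolyTimeComputable.of_comp_encode`;
* BAD MASS `≤ 1/3` AT EVERY LEVEL: below `n₀` the table answers exactly `[x ∈ IQ3]` on the support
  of `Uₙ` (and `0` on the point mass `[]` of an empty block), so no supported input is bad; from
  `n₀` on, an input `bin d` with `d` in the agreement set has coin error `≤ 1/8 < 1/4` (its output
  distribution is that of the witness algorithm, `Negative.pr_paramLift`), so the bad inputs of the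
  block lie in the disagreement set, of `Uₙ`-mass `≤ 1/3` (`Negative.ens_prob_eq`).

Theorem-only file; the algorithm `B` is a local `let` described to the helper lemmas by the two
hypotheses `hrun`/`hcoin`. Adapted from the disprover's `Cruxes/AvgFaceBeyondPrior/Disproof.lean`
§3 (`tableFn`, `patchAlg`, `paramEnc_inj`, `avgFace_imp_exists_level_ge`; its finite table is
re-derived here as the existence statement `exists_table_mem_FP`, and the injectivity of `paramEnc`
is inlined, so that this file depends only on the built `Negative/*Necessary|Blocks` files), reusing
the landed `Negative.paramLift`, `Negative.pr_paramLift` (pattern `mem_HeurDeltaBPP_of_mem_BPP`).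
-/

namespace Summit.QuantumAdvantage.QuantumAdvantage.Theorems.AvgFaceBeyondPrior.Mirror

open Filter _root_.Computability Literature.Computability.Complexity
  Literature.Computability.MetaComplexity Literature.NumberTheory.QuadraticFields
open Summit.QuantumAdvantage.QuantumAdvantage.Theorems.AvgFaceBeyondPrior
open scoped Classical

/-! ## §1 String-level bricks: finite tables, the patched run map is in `FP` -/

/-- **Finite tables are polynomial time**: for every finite list `l` of strings some `FP` string
function answers the one-bit membership query `z ↦ [z ∈ l]` (equality test with a constant after a
fan-out, then branch; induction on `l`). Existence form of the disprover's `tableFn_mem_FP`.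
[cite: AroraBarak2009, §1.3] -/
theorem exists_table_mem_FP (l : List (List Bool)) :
    ∃ t : List Bool → List Bool, t ∈ FP ∧ ∀ z, t z = [decide (z ∈ l)] := by
  induction l with
  | nil => exact ⟨fun _ => [false], const_mem_FP [false], fun z => by simp⟩
  | cons u us ih =>
    obtain ⟨t, ht, htz⟩ := ih
    refine ⟨iteFn (eqPairFn ∘ fanoutFn id fun _ => u) (fun _ => [true]) t,
      iteFn_mem_FP (comp_mem_FP eqPairFn_mem_FP
        (fanoutFn_mem_FP (PolyTimeComputable.id _) (const_mem_FP u))) (const_mem_FP [true]) ht,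
      fun z => ?_⟩
    have hc : (eqPairFn ∘ fanoutFn id fun _ => u) z = [decide (z = u)] := by
      simp only [Function.comp_apply, fanoutFn_apply, eqPairFn_boolPair, id]
    rw [iteFn_apply hc, htz]
    by_cases h : z = u
    · subst h; simp
    · simp [h]

/-- The unary codes of the numbers below `n₀`, as a membership test: `1ⁿ` is in the list iff
`n < n₀`. [folklore] -/
theorem unaryEncodeNat_mem_map_range (n n₀ : ℕ) :
    unaryEncodeNat n ∈ (List.range n₀).map unaryEncodeNat ↔ n < n₀ := by
  rw [List.mem_map]
  constructor
  · rintro ⟨a, ha, he⟩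
    have h := congrArg unaryDecodeNat he
    rw [unary_decode_encode_nat, unary_decode_encode_nat] at h
    rw [List.mem_range] at ha
    omega
  · exact fun h => ⟨n, List.mem_range.2 h, rfl⟩

/-- **Semantics of the patched run map** on a well-formed input `⟨⟨x, 1ⁿ⟩, r⟩`: table hit ↦ `[1]`;
else small parameter ↦ `[0]`; else the verdict `[⟨x, r ↾ p(|x|)⟩ ∈ L']`. [folklore] -/
theorem patchFn_apply (L' : Language Bool) (p : Polynomial ℕ) (S₀ : Finset (List Bool)) (n₀ : ℕ)
    {t₁ t₂ : List Bool → List Bool} (ht₁ : ∀ z, t₁ z = [decide (z ∈ S₀.toList)])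
    (ht₂ : ∀ z, t₂ z = [decide (z ∈ (List.range n₀).map unaryEncodeNat)])
    (x : List Bool) (n : ℕ) (r : List Bool) :
    iteFn (t₁ ∘ fun z => (boolUnpair z).1) (fun _ => [true])
      (iteFn (t₂ ∘ ((fun z : List Bool => (boolUnpair z).2) ∘ fun z => (boolUnpair z).1))
        (fun _ => [false])
        ((fun z => encodeBool (L'.boolIndicator z)) ∘ (truncSndFn p ∘
          fanoutFn ((fun z : List Bool => (boolUnpair z).1) ∘ fun z => (boolUnpair z).1)
            fun z => (boolUnpair z).2)))
      (boolPair (paramEnc (x, n)) r) =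
    encodeBool (if paramEnc (x, n) ∈ S₀ then true else if n < n₀ then false
      else L'.boolIndicator (boolPair x (r.take (p.eval x.length)))) := by
  have hc₁ : (t₁ ∘ fun z => (boolUnpair z).1) (boolPair (paramEnc (x, n)) r) =
      [decide (paramEnc (x, n) ∈ S₀)] := by
    simp only [Function.comp_apply, boolUnpair_boolPair, ht₁, Finset.mem_toList]
  by_cases h1 : paramEnc (x, n) ∈ S₀
  · rw [iteFn_apply_true (by rw [hc₁, decide_eq_true h1]), if_pos h1]
    rfl
  rw [iteFn_apply_false (by rw [hc₁, decide_eq_false h1]), if_neg h1]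
  have hc₂ : (t₂ ∘ ((fun z : List Bool => (boolUnpair z).2) ∘ fun z => (boolUnpair z).1))
      (boolPair (paramEnc (x, n)) r) = [decide (n < n₀)] := by
    simp only [Function.comp_apply, boolUnpair_boolPair, paramEnc, ht₂]
    rw [Bool.decide_congr (unaryEncodeNat_mem_map_range n n₀)]
  by_cases h2 : n < n₀
  · rw [iteFn_apply_true (by rw [hc₂, decide_eq_true h2]), if_pos h2]
    rfl
  rw [iteFn_apply_false (by rw [hc₂, decide_eq_false h2]), if_neg h2]
  simp only [Function.comp_apply, fanoutFn_apply, boolUnpair_boolPair, paramEnc, truncSndFn_boolPair]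

/-- **The patched algorithm is PPT.** Any `B : RandAlg (List Bool × ℕ) Bool` whose run map is the
patched map (`hrun`) and whose coin budget is the polynomial `p` (`hcoin`) is probabilistic
polynomial time on parametrised inputs: its run map, read from `boolPair (paramEnc q) r`, is the
`FP` string function of `patchFn_apply` (`iteFn_mem_FP`, tables, projections, `truncSndFn_mem_FP`,
`indicatorFn_mem_FP`), transported by `PolyTimeComputable.of_comp_encode`.
[cite: AroraBarak2009, §1.3] -/
theorem isPolyTime_patched {L' : Language Bool} (hL' : L' ∈ Classes.P) (p : Polynomial ℕ)
    (S₀ : Finset (List Bool)) (n₀ : ℕ) (B : RandAlg (List Bool × ℕ) Bool)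
    (hrun : ∀ q r, B.run q r =
      if paramEnc q ∈ S₀ then true else if q.2 < n₀ then false
      else L'.boolIndicator (boolPair q.1 (r.take (p.eval q.1.length))))
    (hcoin : ∀ m, B.coinLen m = p.eval m) :
    B.IsPolyTime paramEnc encodeBool := by
  obtain ⟨t₁, ht₁, ht₁z⟩ := exists_table_mem_FP S₀.toList
  obtain ⟨t₂, ht₂, ht₂z⟩ := exists_table_mem_FP ((List.range n₀).map unaryEncodeNat)
  have hfst : (fun z : List Bool => (boolUnpair z).1) ∈ FP := boolUnpairFst_mem_FP
  have hsnd : (fun z : List Bool => (boolUnpair z).2) ∈ FP := boolUnpairSnd_mem_FP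
  have hG : (iteFn (t₁ ∘ fun z => (boolUnpair z).1) (fun _ => [true])
      (iteFn (t₂ ∘ ((fun z : List Bool => (boolUnpair z).2) ∘ fun z => (boolUnpair z).1))
        (fun _ => [false])
        ((fun z => encodeBool (L'.boolIndicator z)) ∘ (truncSndFn p ∘
          fanoutFn ((fun z : List Bool => (boolUnpair z).1) ∘ fun z => (boolUnpair z).1)
            fun z => (boolUnpair z).2)))) ∈ FP :=
    iteFn_mem_FP (comp_mem_FP ht₁ hfst) (const_mem_FP _)
      (iteFn_mem_FP (comp_mem_FP ht₂ (comp_mem_FP hsnd hfst)) (const_mem_FP _)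
        (comp_mem_FP (indicatorFn_mem_FP hL')
          (comp_mem_FP (truncSndFn_mem_FP p) (fanoutFn_mem_FP (comp_mem_FP hfst hfst) hsnd))))
  refine ⟨hG.of_comp_encode (fun a => boolPair (paramEnc a.1) a.2) (fun _ => rfl) fun a => ?_,
    p, fun m => (hcoin m).le⟩
  obtain ⟨⟨x, n⟩, r⟩ := a
  show encodeBool (B.run (x, n) r) = _
  rw [hrun]
  exact (patchFn_apply L' p S₀ n₀ ht₁z ht₂z x n r).symm

/-! ## §2 Output probabilities of the patched algorithm -/

/-- A coin-free branch answers its constant: the probability of the complementary bit is `0`.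
[folklore] -/
theorem pr_ne_of_run_const {α : Type} (B : RandAlg α Bool) (ea : α → List Bool) (x : α) (c : Bool)
    (hrun : ∀ r, B.run x r = c) : B.pr ea x {b | b ≠ c} = 0 := by
  have h : B.outputPMF ea x = PMF.pure c := by
    simp only [RandAlg.outputPMF, hrun]
    exact PMF.map_const _ _
  rw [RandAlg.pr, h, PMF.toOuterMeasure_pure_apply, if_neg (by simp)]
  simp

/-- Two algorithms with the same run map at `x` and the same coin budget there have the same output
probabilities at `x` (`RandAlg.pr_eq_uniformProb`). [folklore] -/
theorem pr_congr_run {α β : Type} {A B : RandAlg α β} (ea : α → List Bool) (x : α)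
    (hcoin : B.coinLen (ea x).length = A.coinLen (ea x).length)
    (hrun : ∀ r, B.run x r = A.run x r) (E : Set β) : B.pr ea x E = A.pr ea x E := by
  rw [RandAlg.pr_eq_uniformProb, RandAlg.pr_eq_uniformProb, hcoin]
  simp only [hrun]

/-- **The fall-through branch has the output distribution of the witness algorithm**: where `B`
answers `[⟨x, r ↾ p(|x|)⟩ ∈ L']` with coin budget `p`, it is the parameter-dropping lift of the
coin-truncated `witnessAlg L' p` (`Negative.pr_paramLift`, `RandAlg.pr_truncate`).
[cite: BogdanovTrevisan2006, §2.3] -/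
theorem pr_fallthrough (L' : Language Bool) (p : Polynomial ℕ) (B : RandAlg (List Bool × ℕ) Bool)
    (x : List Bool) (n : ℕ)
    (hrun : ∀ r, B.run (x, n) r = L'.boolIndicator (boolPair x (r.take (p.eval x.length))))
    (hcoin : ∀ m, B.coinLen m = p.eval m) (E : Set Bool) :
    B.pr paramEnc (x, n) E = (witnessAlg L' p).pr id x E := by
  have hobl : ∀ y r, ((witnessAlg L' p).truncate id).run y r =
      ((witnessAlg L' p).truncate id).run y
        (r.take (((witnessAlg L' p).truncate id).coinLen y.length)) :=
    fun y r => ((witnessAlg L' p).truncate_run_take id y r).symm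
  have h1 : B.pr paramEnc (x, n) E =
      (Negative.paramLift ((witnessAlg L' p).truncate id)).pr paramEnc (x, n) E :=
    pr_congr_run paramEnc (x, n) (hcoin _) (fun r => hrun r) E
  rw [h1, Negative.pr_paramLift _ ⟨p, fun _ => rfl⟩ hobl, RandAlg.pr_truncate]

/-! ## §3 The table and the bad inputs -/

/-- **The table**: the codes `⟨bin d, 1ᵐ⟩` with `m < n₀` and `d ∈ 𝒟ₘ ∩ IQ3`, and its membership
test (adapted from `avgFace_imp_exists_level_ge` / `paramEnc_inj` of the disprover's work file).
[folklore] -/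
theorem mem_table_iff (n₀ : ℕ) (x : List Bool) (m : ℕ) :
    paramEnc (x, m) ∈ ((Finset.range n₀).biUnion fun k =>
        ((Negative.fundBlock k).filter fun d => d ∈ Negative.iq3Set).image
          fun d => paramEnc (encodeNat d, k)) ↔
      m < n₀ ∧ ∃ d ∈ Negative.fundBlock m, d ∈ Negative.iq3Set ∧ x = encodeNat d := by
  simp only [Finset.mem_biUnion, Finset.mem_range, Finset.mem_image, Finset.mem_filter]
  constructor
  · rintro ⟨m', hm', d, ⟨hd, hd3⟩, he⟩
    -- `paramEnc` is injective in both arguments (`boolPair_injective`, unary codes)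
    have h2 := boolPair_injective (a₁ := (encodeNat d, unaryEncodeNat m'))
      (a₂ := (x, unaryEncodeNat m)) he
    simp only [Prod.mk.injEq] at h2
    have h3 := congrArg unaryDecodeNat h2.2
    rw [unary_decode_encode_nat, unary_decode_encode_nat] at h3
    subst h3
    exact ⟨hm', d, hd, hd3, h2.1.symm⟩
  · rintro ⟨hm, d, hd, hd3, rfl⟩
    exact ⟨m, hm, d, ⟨hd, hd3⟩, rfl⟩

/-- **Bad supported inputs lie in the late disagreement set.** For the patched algorithm (`hrun`,
`hcoin`) built on a witness `L'`, `p` with coin error `≤ 1/8` for `bin T` (`hp`) and the table of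
`IQ3` below `n₀` (`hS`): if `bin d`, `d ∈ 𝒟ₙ`, is bad (coin error `≥ 1/4` about `IQ3`) then
`n ≥ n₀` and `d` is a disagreement (`¬ (3 ∣ h(−d) ↔ d ∈ T)`). Below `n₀` the table is exact on the
block; from `n₀` on, agreement makes `[bin d ∈ IQ3] = [bin d ∈ bin T]` and the error is `≤ 1/8`.
[cite: BogdanovTrevisan2006, §2.3] -/
theorem late_disagree_of_bad {T : Set ℕ} {L' : Language Bool} {p : Polynomial ℕ}
    (hp : ∀ x : List Bool, uniformProb (p.eval x.length)
      {y : List Bool | ¬ (boolPair x y ∈ L' ↔ x ∈ encodingNatBool.toLanguage T)} ≤ 1 / 8)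
    {S₀ : Finset (List Bool)} {n₀ : ℕ}
    (hS : ∀ x m, paramEnc (x, m) ∈ S₀ ↔
      m < n₀ ∧ ∃ d ∈ Negative.fundBlock m, d ∈ Negative.iq3Set ∧ x = encodeNat d)
    (B : RandAlg (List Bool × ℕ) Bool)
    (hrun : ∀ q r, B.run q r =
      if paramEnc q ∈ S₀ then true else if q.2 < n₀ then false
      else L'.boolIndicator (boolPair q.1 (r.take (p.eval q.1.length))))
    (hcoin : ∀ m, B.coinLen m = p.eval m) {n d : ℕ} (hd : d ∈ Negative.fundBlock n)
    (hbad : (1:ℝ) / 4 ≤ B.pr paramEnc (encodeNat d, n)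
      {b | b ≠ Negative.iq3Lang.boolIndicator (encodeNat d)}) :
    n₀ ≤ n ∧ ¬ (3 ∣ BinaryQuadraticForm.classNumber (-(d:ℤ)) ↔ d ∈ T) := by
  by_cases h1 : paramEnc (encodeNat d, n) ∈ S₀
  · -- table hit: the answer `1` is right
    exfalso
    obtain ⟨-, d', -, hd3', he⟩ := (hS _ _).1 h1
    have hdd : d = d' := encodingNatBool.encode_injective he
    subst hdd
    rw [(Set.mem_iff_boolIndicator _ _).1 ((Negative.encodeNat_mem_iq3Lang d).2 hd3'),
      pr_ne_of_run_const B paramEnc _ true (fun r => by rw [hrun, if_pos h1])] at hbad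
    norm_num at hbad
  by_cases h2 : n < n₀
  · -- early level, no hit: the answer `0` is right
    exfalso
    have hd3 : d ∉ Negative.iq3Set := fun hd3 => h1 ((hS _ _).2 ⟨h2, d, hd, hd3, rfl⟩)
    rw [(Set.notMem_iff_boolIndicator _ _).1
        (fun h => hd3 ((Negative.encodeNat_mem_iq3Lang d).1 h)),
      pr_ne_of_run_const B paramEnc _ false (fun r => by rw [hrun, if_neg h1, if_pos h2])] at hbad
    norm_num at hbad
  -- late level: the witness algorithm, error ≤ 1/8 on the agreement set
  refine ⟨not_lt.1 h2, fun hagree => ?_⟩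
  have hfund := (Finset.mem_filter.1 hd).2
  have hiff : encodeNat d ∈ Negative.iq3Lang ↔ encodeNat d ∈ encodingNatBool.toLanguage T := by
    have hT : encodeNat d ∈ encodingNatBool.toLanguage T ↔ d ∈ T :=
      encodingNatBool.mem_toLanguage_iff T d
    rw [Negative.encodeNat_mem_iq3Lang, hT]
    exact ⟨fun h => hagree.1 h.2, fun h => ⟨hfund, hagree.2 h⟩⟩
  have hind : Negative.iq3Lang.boolIndicator (encodeNat d) =
      (encodingNatBool.toLanguage T).boolIndicator (encodeNat d) := by
    by_cases hx : encodeNat d ∈ Negative.iq3Lang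
    · rw [(Set.mem_iff_boolIndicator _ _).1 hx, (Set.mem_iff_boolIndicator _ _).1 (hiff.1 hx)]
    · rw [(Set.notMem_iff_boolIndicator _ _).1 hx,
        (Set.notMem_iff_boolIndicator _ _).1 fun h => hx (hiff.2 h)]
  have hrun' : ∀ r, B.run (encodeNat d, n) r =
      L'.boolIndicator (boolPair (encodeNat d) (r.take (p.eval (encodeNat d).length))) := fun r => by
    rw [hrun, if_neg h1, if_neg h2]
  rw [hind, pr_fallthrough L' p B (encodeNat d) n hrun' hcoin, witnessAlg_pr_ne] at hbad
  have := hp (encodeNat d)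
  linarith

/-- **The point mass `[]` of an empty block is never bad below `n₀`**: `[]` is not the code of any
`d ∈ 𝒟ₘ` (`d ≥ 1`), so the table misses, the answer is `0`, and `[] ∉ IQ3`
(`Negative.nil_not_mem_iq3Lang`). [folklore] -/
theorem not_bad_nil {L' : Language Bool} {p : Polynomial ℕ} {S₀ : Finset (List Bool)} {n₀ : ℕ}
    (hS : ∀ x m, paramEnc (x, m) ∈ S₀ ↔
      m < n₀ ∧ ∃ d ∈ Negative.fundBlock m, d ∈ Negative.iq3Set ∧ x = encodeNat d)
    (B : RandAlg (List Bool × ℕ) Bool)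
    (hrun : ∀ q r, B.run q r =
      if paramEnc q ∈ S₀ then true else if q.2 < n₀ then false
      else L'.boolIndicator (boolPair q.1 (r.take (p.eval q.1.length))))
    {n : ℕ} (hn : n < n₀) :
    ¬ ((1:ℝ) / 4 ≤ B.pr paramEnc (([] : List Bool), n)
      {b | b ≠ Negative.iq3Lang.boolIndicator ([] : List Bool)}) := by
  have h1 : paramEnc (([] : List Bool), n) ∉ S₀ := by
    intro h
    obtain ⟨-, d, hd, -, he⟩ := (hS _ _).1 h
    have hd1 : 1 ≤ d := le_trans Nat.one_le_two_pow (Finset.mem_Ico.1 (Finset.mem_filter.1 hd).1).1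
    have hdec := congrArg decodeNat he
    rw [decode_encodeNat] at hdec
    have h00 : decodeNat [] = 0 := by decide
    omega
  rw [(Set.notMem_iff_boolIndicator _ _).1 Negative.nil_not_mem_iq3Lang,
    pr_ne_of_run_const B paramEnc _ false (fun r => by rw [hrun, if_neg h1, if_pos hn])]
  norm_num

/-! ## §4 The transfer -/

/-- **The mirror transfer** (stub `stub_heurTransfer` of line `mirror-unit-signature`): if a set `T`
agrees with `IQ3` off a `(1/6 + ε)`-fraction of every late block and `bin T ∈ BPP`, then the crux
`AvgFaceBeyondPrior = ((IQ3, U) ∉ Heur_{1/3}BPP)` fails — the patched, parameter-lifted,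
error-reduced `BPP` machine has bad `Uₙ`-mass `0` below `n₀` and `≤ 1/6 + 1/6 = 1/3` from `n₀` on.
[cite: BogdanovTrevisan2006, §2.3] -/
theorem stub_heurTransfer :
    ∀ T : Set ℕ,
      (∀ ε : ℝ, 0 < ε → ∀ᶠ n : ℕ in atTop,
        ((((Negative.fundBlock n).filter fun d : ℕ =>
            ¬ (3 ∣ BinaryQuadraticForm.classNumber (-(d:ℤ)) ↔ d ∈ T)).card : ℝ))
          ≤ (1 / 6 + ε) * ((Negative.fundBlock n).card : ℝ)) →
      encodingNatBool.toLanguage T ∈ BPP →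
      ¬ Summit.QuantumAdvantage.QuantumAdvantage.Theses.ArithStatLadder.AvgFaceBeyondPrior := by
  intro T hagree hT hcrux
  -- error reduction to 1/8: a witness language in P and a coin polynomial
  obtain ⟨L', hL', p, hp⟩ := BPP_subset_bpErr (ε := 1 / 8) (by norm_num) hT
  -- the agreement level n₀ ≥ 2
  obtain ⟨n₁, hn₁⟩ := Filter.eventually_atTop.1 (hagree (1 / 6) (by norm_num))
  obtain ⟨n₀, hn₀₁, hn₀₂⟩ : ∃ n₀, n₁ ≤ n₀ ∧ 2 ≤ n₀ := ⟨max n₁ 2, le_max_left _ _, le_max_right _ _⟩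
  -- the finite table of IQ3 below n₀
  obtain ⟨S₀, hS⟩ : ∃ S₀ : Finset (List Bool), ∀ x m, paramEnc (x, m) ∈ S₀ ↔
      m < n₀ ∧ ∃ d ∈ Negative.fundBlock m, d ∈ Negative.iq3Set ∧ x = encodeNat d :=
    ⟨_, mem_table_iff n₀⟩
  -- the patched algorithm
  let B : RandAlg (List Bool × ℕ) Bool :=
    ⟨fun q r => if paramEnc q ∈ S₀ then true else if q.2 < n₀ then false
      else L'.boolIndicator (boolPair q.1 (r.take (p.eval q.1.length))), fun m => p.eval m⟩
  have hrun : ∀ q r, B.run q r = if paramEnc q ∈ S₀ then true else if q.2 < n₀ then false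
      else L'.boolIndicator (boolPair q.1 (r.take (p.eval q.1.length))) := fun _ _ => rfl
  have hcoin : ∀ m, B.coinLen m = p.eval m := fun _ => rfl
  refine (Negative.avgFace_iff_Q.1 hcrux) ⟨B, isPolyTime_patched hL' p S₀ n₀ B hrun hcoin, fun n => ?_⟩
  change Negative.ens.prob n {x | (1:ℝ) / 4 ≤ B.pr paramEnc (x, n)
    {b | b ≠ Negative.iq3Lang.boolIndicator x}} ≤ 1 / 3
  by_cases hne : (Negative.fundBlock n).Nonempty
  · rw [Negative.ens_prob_eq hne]
    have hcard : (0:ℝ) < (Negative.fundBlock n).card := by exact_mod_cast hne.card_pos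
    rw [div_le_iff₀ hcard]
    by_cases hn : n₀ ≤ n
    · -- late level: bad ∩ block ⊆ disagreement set, of density ≤ 1/6 + 1/6
      refine le_trans (Nat.cast_le.2 <| Finset.card_le_card fun d hd => ?_)
        ((hn₁ n (le_trans hn₀₁ hn)).trans (le_of_eq (by ring)))
      rw [Finset.mem_filter] at hd ⊢
      exact ⟨hd.1, (late_disagree_of_bad hp hS B hrun hcoin hd.1 hd.2).2⟩
    · -- early level: no supported input is bad
      refine le_trans (Nat.cast_le.2 <| Finset.card_le_card (t := (∅ : Finset ℕ)) fun d hd => ?_) ?_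
      · rw [Finset.mem_filter] at hd
        exact absurd (late_disagree_of_bad hp hS B hrun hcoin hd.1 hd.2).1 hn
      · rw [Finset.card_empty, Nat.cast_zero]
        positivity
  · -- empty block (n ≤ 1 < n₀): the point mass [] is answered 0, correctly
    have hn2 : n < 2 := not_le.1 fun h => hne (Negative.Blocks.fundBlock_nonempty h)
    rw [Negative.ens_prob_of_not_nonempty hne]
    split_ifs with hnil
    · exact absurd hnil (not_bad_nil hS B hrun (lt_of_lt_of_le hn2 hn₀₂))
    · norm_num

end Summit.QuantumAdvantage.QuantumAdvantage.Theorems.AvgFaceBeyondPrior.Mirror
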